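/-
Copyright (c) 2026 the pub-hodgecm-mathlib formalisation cell (harness21).  Prover seat hodgecm-mathlib-LH4-p14 (g2), req620 Track A «(D-RAM) FOUR-FRAME» squad
(unit U3_Laws, MS ROAD A Stage A; brick (O2b) «fibre count along a unit-torus orbit» of LH4-p11 (g0)'s cut 23:33:55Z, group-theoretic half; MS first seat LH4-p11 (g0),
Stage B lead LH4-p10 (g2), dealer LH4-plan (g11)).  2026-09-04.
-/
import Mathlib.GroupTheory.Index
import Mathlib.Algebra.Group.Subgroup.Finite
import Mathlib.Data.Fintype.Card
import Mathlib.Tactic.Ring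
import HarnessLib

/-!
# Crux `H413`, line LH4 «(D-RAM) FOUR-FRAME» road — unit U3_Laws (iii), MS ROAD A, brick (O2b) PART 1: TWO GROUP-THEORETIC COUNTS OF THE ORBIT COUNT (3c-iii)

Cell `hodgecm-mathlib` (D-0151), FLOOR 0, crux item H413 = `stmt-HodgeConjecture-24833`, route of record `HCCMUnconditional`; squad F0∕P3c∕LH4 (req618∕req620).  THEOREMS ONLY
(no `def`, no instance, no notation, no `sorry`; Mathlib-only imports); lane `--supports stmt-HodgeConjecture-24833 --as helper` (count-neutral).  Pure group theory for a
COMMUTATIVE group `G` (the reading: `G = (K^×)³`, `T = 𝒯` the unit torus, `U = 𝒰` its `σ`-fixed part, `N` the norm map `z ↦ z·σz`, `S` the diagonal stabiliser of a lattice,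
`S ⊓ T = S̃`, `S ⊓ U = S_F`, `A = N(𝒯)`, the eight representatives `c^e`, `e : Fin 3 → Bool`, of `𝒰 ∕ N𝒯` — LH4-p10 MEMO-stableLaw-finite v1 §2 (3)(b)(c)(d)):
* `card_filter_mem_coset_eq_relIndex` — **REPRESENTATIVES IN A COSET**: if `c : ι → U` is a system of representatives of `U ∕ A` (`∀ x ∈ U, ∃! i, x·(c i)⁻¹ ∈ A`) and
  `A ≤ X ≤ U`, then every coset `w·X` (`w ∈ U`) contains exactly `[X : A]` of the `c i`:  `#{i | w⁻¹·c i ∈ X} = A.relIndex X`;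
* `relIndex_map_sup_mul_relIndex_comap_mul_relIndex_eq` — **THE INDEX IDENTITY OF THE FIBRE COUNT**: with `A = N(T) ≤ U`, `N(S ⊓ T) ≤ S ⊓ U`, `H = T ⊓ N⁻¹(S ⊓ U)`:
  `[A ⊔ (S ⊓ U) : A] · [H : S ⊓ T] · [U : S ⊓ U] = [U : A] · [T : S ⊓ T]` — unconditionally in `ℕ` (Mathlib `Subgroup.relIndex`, `0` = infinite), by `relIndex_comap`
  (`[T : H] = [A : A ⊓ (S ⊓ U)]`), the two diamond identities `relIndex_sup_left∕right` and `relIndex_mul_relIndex` twice.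
HONEST LABEL.  Count-neutral (`--supports`); nothing printed is asserted; (MS) stays a PROVER TARGET; `HC_CM` is proved only modulo the 7 printed citations (2 remaining named inputs:
hLiu418 = `stmt-HodgeConjecture-24832`, h413 = `stmt-HodgeConjecture-24833`) until rung 0 closes.

## References
* [Kottwitz1986BaseChangeUnits] R. E. Kottwitz, *Base change for unit elements of Hecke algebras*, Compositio Math. 60 (1986), §1 pp. 240–241 (the torus-quotient bookkeeping of lattice counts).
* [Serre1979] J.-P. Serre, *Local Fields*, GTM 67 (1979), Ch. V §3 (norm indices; index calculus).
-/

set_option autoImplicit false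

namespace Summit.HodgeConjecture.HodgeConjecture.Cruxes.H413.F0P3cDyRamTorusRepresentativesCount

open Subgroup

/-! ## §1  Representatives of `U ∕ A` inside a coset of an intermediate subgroup -/

/-- **REPRESENTATIVES IN A COSET.**  In a commutative group, let `A ≤ X ≤ U` be subgroups, `c : ι → G` a finite family in `U` which is a system of representatives of `U ∕ A`
(every `x ∈ U` has a unique `i` with `x·(c i)⁻¹ ∈ A`), and `w ∈ U`.  Then `#{i | w⁻¹·c i ∈ X} = [X : A]` (`= A.relIndex X`): the coset `w·X` is a union of `[X : A]`
cosets of `A`, each containing exactly one representative. [cite: Serre1979, Ch. V §3] -/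
theorem card_filter_mem_coset_eq_relIndex {G : Type*} [CommGroup G] {ι : Type*} [Fintype ι]
    (A X U : Subgroup G) (hAX : A ≤ X) (hXU : X ≤ U) (c : ι → G) (hcU : ∀ i, c i ∈ U)
    (hrep : ∀ x ∈ U, ∃! i, x * (c i)⁻¹ ∈ A) (w : G) (hw : w ∈ U) [DecidablePred fun i => w⁻¹ * c i ∈ X] :
    (Finset.univ.filter fun i => w⁻¹ * c i ∈ X).card = A.relIndex X := by
  classical
  rw [Subgroup.relIndex, Subgroup.index, ← Fintype.card_subtype, ← Nat.card_eq_fintype_card]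
  refine Nat.card_congr (Equiv.ofBijective
    (fun i : {i // w⁻¹ * c i ∈ X} => (QuotientGroup.mk (⟨w⁻¹ * c i.1, i.2⟩ : X) : X ⧸ A.subgroupOf X)) ⟨?_, ?_⟩)
  · rintro ⟨i, hi⟩ ⟨j, hj⟩ hij
    have hmem : ((⟨w⁻¹ * c i, hi⟩ : X)⁻¹ * ⟨w⁻¹ * c j, hj⟩) ∈ A.subgroupOf X := QuotientGroup.eq.1 hij
    rw [Subgroup.mem_subgroupOf] at hmem
    have h2 : (((⟨w⁻¹ * c i, hi⟩ : X)⁻¹ * ⟨w⁻¹ * c j, hj⟩ : X) : G) = (c i)⁻¹ * c j := by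
      simp only [Subgroup.coe_mul, Subgroup.coe_inv]
      rw [mul_inv_rev, inv_inv, mul_assoc, mul_inv_cancel_left]
    rw [h2] at hmem
    obtain ⟨k, -, hk⟩ := hrep (c j) (hcU j)
    have hi' : i = k := hk i (show c j * (c i)⁻¹ ∈ A by rw [mul_comm]; exact hmem)
    have hj' : j = k := hk j (show c j * (c j)⁻¹ ∈ A by rw [mul_inv_cancel]; exact A.one_mem)
    exact Subtype.ext (hi'.trans hj'.symm)
  · rintro q
    induction q using QuotientGroup.induction_on with
    | H x =>
      obtain ⟨i, hi, -⟩ := hrep (w * x) (U.mul_mem hw (hXU x.2))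
      -- `c i = a⁻¹·(w·x)` with `a := w·x·(c i)⁻¹ ∈ A`, hence `w⁻¹·c i = a⁻¹·x ∈ X`
      have hc : c i = (w * x * (c i)⁻¹)⁻¹ * (w * x) := by
        rw [mul_inv_rev, inv_inv, mul_assoc, inv_mul_cancel, mul_one]
      have h1 : w⁻¹ * c i = (w * x * (c i)⁻¹)⁻¹ * x := by
        conv_lhs => rw [hc]
        rw [mul_left_comm, inv_mul_cancel_left]
      have hmemX : w⁻¹ * c i ∈ X := by
        rw [h1]; exact X.mul_mem (X.inv_mem (hAX hi)) x.2
      refine ⟨⟨i, hmemX⟩, ?_⟩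
      apply QuotientGroup.eq.2
      rw [Subgroup.mem_subgroupOf]
      have h2 : (((⟨w⁻¹ * c i, hmemX⟩ : X)⁻¹ * x : X) : G) = w * x * (c i)⁻¹ := by
        simp only [Subgroup.coe_mul, Subgroup.coe_inv]
        rw [h1, mul_inv_rev, inv_inv, inv_mul_cancel_comm]
      rw [h2]
      exact hi

/-! ## §2  The index identity -/

/-- **THE INDEX IDENTITY OF THE FIBRE COUNT** (MEMO-stableLaw-finite v1 §2 (3)(d), in the shape the (O2b) count produces).  In a commutative group with subgroups `T, U, S`, an
endomorphism `N` with `N(T) ≤ U` and `N(S ⊓ T) ≤ S ⊓ U`, writing `A := N(T)`, `S_F := S ⊓ U`, `S̃ := S ⊓ T`, `H := T ⊓ N⁻¹(S_F)`: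
`[A ⊔ S_F : A] · [H : S̃] · [U : S_F] = [U : A] · [T : S̃]` in `ℕ` (every bracket a Mathlib `relIndex`; no finiteness hypothesis).  Proof: `[T : S̃] = [T : H]·[H : S̃]`,
`[T : H] = [A : A ⊓ S_F] = [A ⊔ S_F : S_F]` (`relIndex_comap` + diamond), `[U : A] = [U : A ⊔ S_F]·[A ⊔ S_F : A]`, `[U : S_F] = [U : A ⊔ S_F]·[A ⊔ S_F : S_F]`.
[cite: Kottwitz1986BaseChangeUnits, §1 pp. 240–241] [cite: Serre1979, Ch. V §3] -/
theorem relIndex_map_sup_mul_relIndex_comap_mul_relIndex_eq {G : Type*} [CommGroup G] (T U S : Subgroup G) (N : G →* G)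
    (hNT : T.map N ≤ U) (hNS : (S ⊓ T).map N ≤ S ⊓ U) :
    (T.map N).relIndex (T.map N ⊔ S ⊓ U) * (S ⊓ T).relIndex (T ⊓ (S ⊓ U).comap N) * (S ⊓ U).relIndex U
      = (T.map N).relIndex U * (S ⊓ T).relIndex T := by
  have hXU : T.map N ⊔ S ⊓ U ≤ U := sup_le hNT inf_le_right
  have hStH : S ⊓ T ≤ T ⊓ (S ⊓ U).comap N := by
    intro x hx
    rw [Subgroup.mem_inf, Subgroup.mem_comap]
    exact ⟨(Subgroup.mem_inf.1 hx).2, hNS (Subgroup.mem_map_of_mem N hx)⟩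
  have e1 : (S ⊓ T).relIndex (T ⊓ (S ⊓ U).comap N) * (T ⊓ (S ⊓ U).comap N).relIndex T = (S ⊓ T).relIndex T :=
    relIndex_mul_relIndex _ _ _ hStH inf_le_left
  have e2 : (T ⊓ (S ⊓ U).comap N).relIndex T = (S ⊓ U).relIndex (T.map N) := by
    rw [inf_comm, inf_relIndex_right, relIndex_comap]
  have e4 : (S ⊓ U).relIndex (T.map N ⊔ S ⊓ U) = (S ⊓ U).relIndex (T.map N) := relIndex_sup_right _ _
  have e5 : (T.map N).relIndex (T.map N ⊔ S ⊓ U) * (T.map N ⊔ S ⊓ U).relIndex U = (T.map N).relIndex U :=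
    relIndex_mul_relIndex _ _ _ le_sup_left hXU
  have e6 : (S ⊓ U).relIndex (T.map N ⊔ S ⊓ U) * (T.map N ⊔ S ⊓ U).relIndex U = (S ⊓ U).relIndex U :=
    relIndex_mul_relIndex _ _ _ le_sup_right hXU
  rw [← e5, ← e1, e2, ← e6, e4]
  ring

end Summit.HodgeConjecture.HodgeConjecture.Cruxes.H413.F0P3cDyRamTorusRepresentativesCount
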